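import Summits.Ventures.CertifiedManyBodySolver.Observables.LocalPairCeilingTL
import Summits.Ventures.CertifiedManyBodySolver.Rows.DopedTLPairDominance
import Summits.Ventures.CertifiedManyBodySolver.Rows.DopedTLSpinStar
import Summits.Ventures.CertifiedManyBodySolver.Rows.DopedTLCorrOrigin
import Summits.Ventures.CertifiedManyBodySolver.Certificates.HubbardSquare_n7o8_corr_docc_rows257_261
import HarnessLib

/-!
# Local pair density capped by occupation, `ω(P_x† P_x) ≤ (Σ g²)(ρ(x) − 𝒟(x))`; first certified-input
# thermodynamic-limit pair cells at the M3′ point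

HONEST FRAMING: first certified bounds; not a superconductivity verdict; every number certified or
labelled float.  Speedrun `mbsolver`, seat sr-mbsolver-m3-2 (pairing layer), gen 12, item (D).
Theorem-only; no definition, no named fact; zero compute.

Operator level (`𝔄_{pairRegion S x}`): every term of `P_x = Σ_e (g e/√2)(c_{x↑}c_{x+e,↓} − c_{x↓}c_{x+e,↑})`
annihilates a fermion AT `x`, so `P_x (1 − n_{x↑})(1 − n_{x↓}) = 0` (`localPairAt_mul_vacancy`), i.e.
`P_x = P_x N_x`, `N_x = n_{x↑} + n_{x↓} − n_{x↑}n_{x↓}` (`localPairAt_mul_occ`).  Conjugating the one-pair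
ceiling `P_x† P_x ≤ ν·1`, `ν = Σ_{e∈S} g e²` (`LocalPairCeilingTL`) by the projection `N_x`:
  `P_x† P_x ≤ ν · N_x`                                           (`posSemidef_smul_occ_sub_localPairAt`);
for EVERY state `Re ω(P_x† P_x) ≤ ν (ρ(x) − 𝒟(x))` (`re_pairCorr_self_le_density_sub_docc`; `𝒟(x) =
Re ω(n_{x↑}n_{x↓})`), and for translation-invariant states, with the diagonal dominance of
`Rows/DopedTLPairDominance.lean`, `|Re ω(P_x† P_y)| ≤ ν (ρ − 𝒟)` for ALL `x, y`
(`abs_re_pairCorr_le_density_sub_docc`).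
Rows at the M3′ point (`U = 8`, `n = 7/8`; row states translation invariant with density `7/8`), `d`-wave
(`ν = 4`): KINEMATIC `[−7/2, 7/2]` for every pair row, every `t′`, every window (`m3_dWavePair_upperRow_seven_halves`,
`…_lowerRow_neg_seven_halves`; sharper than the density-blind `[−4, 4]`); a docc LOWER row `M3DoccLowerRow t′ u dlo`
gives the DERIVED cells `±(7/2 − 4·dlo)` (`m3_dWavePair_upperRow_of_doccLowerRow`, `…_lowerRow_…`); at the
LANDED claim nodes of the CERTIFIED docc rows #261 (`t′ = 0`) / #257 (`t′ = −1/4`): DERIVED-CERTIFIED cells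
`|Re ω(P_x† P_y)| ≤ 16649115568364534051996601/2^82 ≈ 3.4429564` (window `u₁₆₆`) / `≤ 4192785280743632199844021/2^80
≈ 3.4681907` (window `u₁₄₉`) for ALL `x, y` (`m3_dWavePair_tp0_upper_of_r261`, `…_lower_of_r261`,
`m3_dWavePair_tpm1o4_upper_of_r257`, `…_lower_of_r257`).  HONEST LABEL: first TL pair cells with a certified
input, but the input moves the edge by `4·dlo ≈ 0.057 / 0.032` only; the content is kinematic (density) —
no pairing statement follows; far from sign-resolving.
References: Bratteli–Robinson I (2nd ed.) §2.3.3, II §5.2.2; Essler et al., The One-Dimensional Hubbard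
Model (2005) §2.1 eq. (2.2), (2.8); Scalapino, Phys. Rep. 250 (1995) 329, §2 eq. (2.4).  Folklore otherwise.
-/

noncomputable section

namespace Summit.Ventures.CertifiedManyBodySolver.Observables
open Matrix Literature.MathematicalPhysics.QuantumLattice Literature.Probability.LatticeModels
open scoped ComplexOrder ComplexConjugate BigOperators

namespace SingletPair

/-- If `A = A N` for a projection `N` (`Nᴴ = N`, `N² = N`) and `A† A ≤ ν·1`, then `A† A ≤ ν·N`
(`N (ν·1 − A†A) N = ν N − A†A`). Bratteli–Robinson I §2.3.3. [folklore] -/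
theorem posSemidef_smul_proj_sub_of_mul_proj {n : Type*} [Fintype n] [DecidableEq n]
    {A N : Matrix n n ℂ} {ν : ℝ} (hN : Nᴴ = N) (hN2 : N * N = N) (hAN : A * N = A)
    (hA : (((ν : ℝ) : ℂ) • (1 : Matrix n n ℂ) - Aᴴ * A).PosSemidef) :
    (((ν : ℝ) : ℂ) • N - Aᴴ * A).PosSemidef := by
  have h := hA.conjTranspose_mul_mul_same N
  have hNA : N * Aᴴ = Aᴴ := by rw [← hN, ← Matrix.conjTranspose_mul, hAN]
  have key : Nᴴ * ((((ν : ℝ) : ℂ)) • (1 : Matrix n n ℂ) - Aᴴ * A) * N = (((ν : ℝ) : ℂ)) • N - Aᴴ * A := by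
    rw [hN, Matrix.mul_sub, Matrix.sub_mul, Matrix.mul_smul, Matrix.mul_one, Matrix.smul_mul, hN2,
      ← Matrix.mul_assoc, hNA, Matrix.mul_assoc, hAN]
  rwa [key] at h

/-- `c_{xσ} (1 − n_{xσ}) = 0` in `𝔄_Λ` (from `c_i n_i = c_i`). Essler et al. (2005) §2.1 eq. (2.8). [folklore] -/
theorem cAt_mul_one_sub_nAt {d : ℕ} {Λ : Finset (Site d)} (x : Site d) (hx : x ∈ Λ) (σ : Fin 2) :
    (cAt x hx σ : FermionOp Λ) * (1 - nAt x hx σ) = 0 := by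
  rw [Matrix.mul_sub, Matrix.mul_one, sub_eq_zero]
  exact (SusyTJ.annihilation_mul_number_self _).symm

/-- `c_{yσ} (1 − n_{xτ}) = (1 − n_{xτ}) c_{yσ}` in `𝔄_Λ` for different spins `σ ≠ τ` (any sites). [folklore] -/
theorem cAt_mul_one_sub_nAt_of_ne {d : ℕ} {Λ : Finset (Site d)} {x y : Site d} (hx : x ∈ Λ)
    (hy : y ∈ Λ) {σ τ : Fin 2} (h : σ ≠ τ) :
    (cAt y hy σ : FermionOp Λ) * (1 - nAt x hx τ) = (1 - nAt x hx τ) * cAt y hy σ := by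
  rw [Matrix.mul_sub, Matrix.sub_mul, Matrix.mul_one, Matrix.one_mul]
  exact congrArg (cAt y hy σ - ·)
    (FermionSpinMoment.annihilation_mul_number_of_ne fun h' => h (orb_eq_orb_iff.1 h').2.symm)

section Pair

variable (S : Finset (Site 2)) (g : Site 2 → ℝ) (x : Site 2)

/-- **`P_x (1 − n_{x↑})(1 − n_{x↓}) = 0`** in `𝔄_{pairRegion S x}`: every term of the local singlet pair
annihilates a fermion at its centre `x`. Essler et al. (2005) §2.1 eq. (2.8); Scalapino 1995 §2 eq. (2.2). [folklore] -/
theorem localPairAt_mul_vacancy :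
    localPairAt S g x * ((1 - nAt x (self_mem_pairRegion S x) 0) *
      (1 - nAt x (self_mem_pairRegion S x) 1)) = 0 := by
  have hE : Commute (1 - nAt x (self_mem_pairRegion S x) 0 : FermionOp (pairRegion S x))
      (1 - nAt x (self_mem_pairRegion S x) 1) :=
    (Commute.one_right _).sub_right ((Commute.one_left _).sub_left (numberAt_commute _ _))
  unfold localPairAt
  rw [Finset.sum_mul]
  refine Finset.sum_eq_zero fun e _ => ?_
  rw [smul_mul_assoc, sub_mul, smul_eq_zero]
  refine Or.inr ?_
  have t1 : cAt x (self_mem_pairRegion S x) 0 * cAt (x + e.1) (add_mem_pairRegion x e.2) 1 *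
      ((1 - nAt x (self_mem_pairRegion S x) 0) * (1 - nAt x (self_mem_pairRegion S x) 1)) = 0 := by
    rw [← Matrix.mul_assoc, Matrix.mul_assoc (cAt x _ 0),
      cAt_mul_one_sub_nAt_of_ne _ _ (show (1 : Fin 2) ≠ 0 by decide), ← Matrix.mul_assoc,
      cAt_mul_one_sub_nAt, Matrix.zero_mul, Matrix.zero_mul]
  have t2 : cAt x (self_mem_pairRegion S x) 1 * cAt (x + e.1) (add_mem_pairRegion x e.2) 0 *
      ((1 - nAt x (self_mem_pairRegion S x) 0) * (1 - nAt x (self_mem_pairRegion S x) 1)) = 0 := by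
    rw [hE.eq, ← Matrix.mul_assoc, Matrix.mul_assoc (cAt x _ 1),
      cAt_mul_one_sub_nAt_of_ne _ _ (show (0 : Fin 2) ≠ 1 by decide), ← Matrix.mul_assoc,
      cAt_mul_one_sub_nAt, Matrix.zero_mul, Matrix.zero_mul]
  rw [t1, t2, sub_zero]

/-- **`P_x = P_x N_x`** with the occupation projection `N_x = n_{x↑} + n_{x↓} − n_{x↑}n_{x↓}`. [folklore] -/
theorem localPairAt_mul_occ :
    localPairAt S g x * (nAt x (self_mem_pairRegion S x) 0 + nAt x (self_mem_pairRegion S x) 1 -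
      nAt x (self_mem_pairRegion S x) 0 * nAt x (self_mem_pairRegion S x) 1) = localPairAt S g x := by
  rw [show (nAt x (self_mem_pairRegion S x) 0 + nAt x (self_mem_pairRegion S x) 1 -
      nAt x (self_mem_pairRegion S x) 0 * nAt x (self_mem_pairRegion S x) 1 : FermionOp (pairRegion S x)) =
      1 - (1 - nAt x (self_mem_pairRegion S x) 0) * (1 - nAt x (self_mem_pairRegion S x) 1) by
        noncomm_ring,
    Matrix.mul_sub, Matrix.mul_one, localPairAt_mul_vacancy, sub_zero]

/-- The occupation operator `N_x = n_{x↑} + n_{x↓} − n_{x↑}n_{x↓}` is Hermitian. [folklore] -/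
theorem occ_conjTranspose {Λ : Finset (Site 2)} (hx : x ∈ Λ) :
    (nAt x hx 0 + nAt x hx 1 - nAt x hx 0 * nAt x hx 1 : FermionOp Λ)ᴴ =
      nAt x hx 0 + nAt x hx 1 - nAt x hx 0 * nAt x hx 1 := by
  have h0 : (nAt x hx 0 : FermionOp Λ)ᴴ = nAt x hx 0 := (numberAt_isHermitian _).eq
  have h1 : (nAt x hx 1 : FermionOp Λ)ᴴ = nAt x hx 1 := (numberAt_isHermitian _).eq
  have hc : (nAt x hx 0 : FermionOp Λ) * nAt x hx 1 = nAt x hx 1 * nAt x hx 0 := (numberAt_commute _ _).eq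
  rw [Matrix.conjTranspose_sub, Matrix.conjTranspose_add, Matrix.conjTranspose_mul, h0, h1, ← hc]

/-- The occupation operator `N_x = 1 − (1 − n_{x↑})(1 − n_{x↓})` is idempotent. [folklore] -/
theorem occ_mul_occ {Λ : Finset (Site 2)} (hx : x ∈ Λ) :
    (nAt x hx 0 + nAt x hx 1 - nAt x hx 0 * nAt x hx 1 : FermionOp Λ) *
        (nAt x hx 0 + nAt x hx 1 - nAt x hx 0 * nAt x hx 1) =
      nAt x hx 0 + nAt x hx 1 - nAt x hx 0 * nAt x hx 1 := by
  have hE : Commute (1 - nAt x hx 0 : FermionOp Λ) (1 - nAt x hx 1) :=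
    (Commute.one_right _).sub_right ((Commute.one_left _).sub_left (numberAt_commute _ _))
  have hid : IsIdempotentElem
      (1 - (1 - nAt x hx 0) * (1 - nAt x hx 1) : FermionOp Λ) :=
    ((numberAt_idempotent _).one_sub.mul_of_commute hE (numberAt_idempotent _).one_sub).one_sub
  rw [show (nAt x hx 0 + nAt x hx 1 - nAt x hx 0 * nAt x hx 1 : FermionOp Λ) =
      1 - (1 - nAt x hx 0) * (1 - nAt x hx 1) by noncomm_ring]
  exact hid.eq

/-- **Operator inequality `P_x† P_x ≤ (Σ_{e∈S} g e²) · (n_{x↑} + n_{x↓} − n_{x↑}n_{x↓})`** in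
`𝔄_{pairRegion S x}` (`g 0 = 0` if `0 ∈ S`): the one-pair ceiling conjugated by the occupation projection.
Scalapino 1995 §2 eq. (2.4); Bratteli–Robinson I §2.3.3. [folklore] -/
theorem posSemidef_smul_occ_sub_localPairAt (hg : (0 : Site 2) ∈ S → g 0 = 0) :
    ((((∑ e ∈ S, g e ^ 2 : ℝ)) : ℂ) •
        (nAt x (self_mem_pairRegion S x) 0 + nAt x (self_mem_pairRegion S x) 1 -
          nAt x (self_mem_pairRegion S x) 0 * nAt x (self_mem_pairRegion S x) 1) -
      (localPairAt S g x)ᴴ * localPairAt S g x).PosSemidef :=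
  posSemidef_smul_proj_sub_of_mul_proj (occ_conjTranspose x _) (occ_mul_occ x _)
    (localPairAt_mul_occ S g x) (posSemidef_smul_one_sub_localPairAt S g x hg)

end Pair

section State

variable (ω : InfVolFermionState 2) (S : Finset (Site 2)) (g : Site 2 → ℝ)

/-- Isotony: the occupation operator of `𝔄_Λ` is read in `𝔄_{{x}}`:
`Re ω_Λ(N_x) = ρ(x) − Re ω(n_{x↑}n_{x↓})`. [cite: ArakiMoriya2003, §4.1 Def. 4.1 (2)] -/
theorem re_expect_occ_eq {Λ : Finset (Site 2)} (x : Site 2) (hx : x ∈ Λ) :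
    (ω.expect Λ (nAt x hx 0 + nAt x hx 1 - nAt x hx 0 * nAt x hx 1)).re =
      ω.densityAt x -
        (ω.expect {x} (nAt x (Finset.mem_singleton_self x) 0 * nAt x (Finset.mem_singleton_self x) 1)).re := by
  have hsub : ({x} : Finset (Site 2)) ⊆ Λ := Finset.singleton_subset_iff.2 hx
  rw [InfVolFermionState.densityAt, ← Complex.sub_re, ← ω.compatible hsub,
    ← ω.compatible hsub (nAt _ _ 0 * nAt _ _ 1), ← map_sub]
  congr 2
  simp only [map_add, map_mul, fermionEmbed_numberOp, PolySite.incl_pt]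

/-- **`Re ω(P_x† P_x) ≤ (Σ_{e∈S} g e²)·(ρ(x) − Re ω(n_{x↑}n_{x↓}))`** for EVERY state `ω` of the lattice
fermions (`g 0 = 0` if `0 ∈ S`). Scalapino 1995 §2 eq. (2.4). [cite: BratteliRobinsonI1987, §2.3.3 (Thm. 2.3.16)] -/
theorem re_pairCorr_self_le_density_sub_docc (x : Site 2) (hg : (0 : Site 2) ∈ S → g 0 = 0) :
    (ω.pairCorr S g x x).re ≤ (∑ e ∈ S, g e ^ 2) * (ω.densityAt x -
      (ω.expect {x} (nAt x (Finset.mem_singleton_self x) 0 * nAt x (Finset.mem_singleton_self x) 1)).re) := by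
  have hP := posSemidef_fermionEmbed
    (PolySite.incl (Finset.subset_union_right : pairRegion S x ⊆ pairRegion S x ∪ pairRegion S x))
    (posSemidef_smul_occ_sub_localPairAt S g x hg)
  rw [fermionEmbed_sub, fermionEmbed_smul, fermionEmbed_mul, fermionEmbed_conjTranspose] at hP
  have h := ω.expect_re_nonneg_of_posSemidef _ hP
  rw [map_sub, map_smul, ω.compatible, Complex.sub_re, smul_eq_mul, Complex.re_ofReal_mul,
    re_expect_occ_eq, sub_nonneg] at h
  rwa [InfVolFermionState.pairCorr, InfVolFermionState.corr_eq, fermionEmbed_conjTranspose]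

variable {ω}

/-- **Translation-invariant states: `Re ω(P_x† P_x) ≤ ν (ρ − 𝒟)`** with `ρ = ω.density` and
`𝒟 = Re ω(n_{0↑}n_{0↓})`. [cite: BratteliRobinsonI1987, §2.3.3 (Thm. 2.3.16)] -/
theorem re_pairCorr_self_le_density_sub_docc_of_isTranslationInvariant
    (hω : ω.IsTranslationInvariant) (x : Site 2) (hg : (0 : Site 2) ∈ S → g 0 = 0) :
    (ω.pairCorr S g x x).re ≤ (∑ e ∈ S, g e ^ 2) * (ω.density - (ω.expect {0} (doccAt0 2)).re) := by
  have h := re_pairCorr_self_le_density_sub_docc ω S g x hg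
  rwa [InfVolFermionState.densityAt, SpinStarTL.re_expect_nAt_add_nAt_eq_density hω x,
    SpinStarTL.expect_nAt_mul_nAt_eq hω x] at h

/-- **Translation-invariant states: `|Re ω(P_x† P_y)| ≤ ν (ρ − 𝒟)` for ALL `x, y`** (diagonal dominance +
occupation cap). [cite: BratteliRobinsonI1987, §2.3.3 (Thm. 2.3.16)] -/
theorem abs_re_pairCorr_le_density_sub_docc (hω : ω.IsTranslationInvariant) (x y : Site 2)
    (hg : (0 : Site 2) ∈ S → g 0 = 0) :
    |(ω.pairCorr S g x y).re| ≤ (∑ e ∈ S, g e ^ 2) * (ω.density - (ω.expect {0} (doccAt0 2)).re) :=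
  (abs_re_pairCorr_le_self S g hω x y).trans
    (re_pairCorr_self_le_density_sub_docc_of_isTranslationInvariant S g hω 0 hg)

/-- `d`-wave, translation-invariant states: `|Re ω.dWavePairCorr x y| ≤ 4 (ρ − 𝒟)`.
Scalapino 1995 §2 eq. (2.3)–(2.4). [cite: BratteliRobinsonI1987, §2.3.3 (Thm. 2.3.16)] -/
theorem abs_re_dWavePairCorr_le_four_mul_density_sub_docc (hω : ω.IsTranslationInvariant)
    (x y : Site 2) :
    |(ω.dWavePairCorr x y).re| ≤ 4 * (ω.density - (ω.expect {0} (doccAt0 2)).re) := by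
  have h := abs_re_pairCorr_le_density_sub_docc (insert 0 unitSteps) dWaveFormFactor hω x y
    (fun _ => dWaveFormFactor_zero)
  rwa [PairFieldYang.sum_sq_dWaveFormFactor] at h

end State

end SingletPair

end Summit.Ventures.CertifiedManyBodySolver.Observables

namespace Summit.Ventures.CertifiedManyBodySolver

open Matrix Literature.MathematicalPhysics.QuantumLattice Literature.Probability.LatticeModels
open Literature.MathematicalPhysics.QuantumLattice.HubbardWave0
open ThermodynamicLimit Filter Topology
open scoped BigOperators ComplexOrder

section M3

variable {tp : ℝ} {u dlo : ℚ}

/-- **M3′, `d`-wave: a docc LOWER row boxes every pair row from above by `7/2 − 4·dlo`**: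
`M3DoccLowerRow t′ u dlo → M3CorrUpperRow t′ u (7/2 − 4 dlo) _ (Γ(P_x)† Γ(P_y))` for all `x, y` (row states:
translation invariant, density `7/8`). DERIVED cell. [cite: BratteliRobinsonI1987, §2.3.3 (Thm. 2.3.16)] -/
theorem m3_dWavePair_upperRow_of_doccLowerRow (hd : M3DoccLowerRow tp u dlo) (x y : Site 2) :
    M3CorrUpperRow tp u (7 / 2 - 4 * dlo)
      (pairRegion (insert 0 unitSteps) x ∪ pairRegion (insert 0 unitSteps) y)
      (fermionEmbed (PolySite.incl Finset.subset_union_left)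
          (localPairAt (insert 0 unitSteps) dWaveFormFactor x)ᴴ *
        fermionEmbed (PolySite.incl Finset.subset_union_right)
          (localPairAt (insert 0 unitSteps) dWaveFormFactor y)) := by
  intro ω Ls ψ hLs hψ hψ1 hω hu
  obtain ⟨hTI, hn⟩ := SpinStarTL.m3_rowState_invariances hLs hψ hψ1 hω
  have hD := hd ω Ls ψ hLs hψ hψ1 hω hu
  have h := Observables.SingletPair.abs_re_dWavePairCorr_le_four_mul_density_sub_docc hTI x y
  rw [hn] at h
  rw [← dWavePairCorr_eq_expect]
  push_cast
  linarith [le_abs_self (ω.dWavePairCorr x y).re]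

/-- **… and from below**: `M3DoccLowerRow t′ u dlo → M3CorrLowerRow t′ u (4 dlo − 7/2) _ (Γ(P_x)† Γ(P_y))`.
DERIVED cell. [cite: BratteliRobinsonI1987, §2.3.3 (Thm. 2.3.16)] -/
theorem m3_dWavePair_lowerRow_of_doccLowerRow (hd : M3DoccLowerRow tp u dlo) (x y : Site 2) :
    M3CorrLowerRow tp u (4 * dlo - 7 / 2)
      (pairRegion (insert 0 unitSteps) x ∪ pairRegion (insert 0 unitSteps) y)
      (fermionEmbed (PolySite.incl Finset.subset_union_left)
          (localPairAt (insert 0 unitSteps) dWaveFormFactor x)ᴴ *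
        fermionEmbed (PolySite.incl Finset.subset_union_right)
          (localPairAt (insert 0 unitSteps) dWaveFormFactor y)) := by
  intro ω Ls ψ hLs hψ hψ1 hω hu
  obtain ⟨hTI, hn⟩ := SpinStarTL.m3_rowState_invariances hLs hψ hψ1 hω
  have hD := hd ω Ls ψ hLs hψ hψ1 hω hu
  have h := Observables.SingletPair.abs_re_dWavePairCorr_le_four_mul_density_sub_docc hTI x y
  rw [hn] at h
  rw [← dWavePairCorr_eq_expect]
  push_cast
  linarith [neg_abs_le (ω.dWavePairCorr x y).re]

/-- **KINEMATIC at density `7/8` (no certificate, every `t′`, every window `u`)**: every `d`-wave pair row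
satisfies `Re ω(P_x† P_y) ≤ 7/2` (`𝒟 ≥ 0`; sharper than the density-blind `4`). [cite: BratteliRobinsonI1987, §2.3.3 (Thm. 2.3.16)] -/
theorem m3_dWavePair_upperRow_seven_halves (tp : ℝ) (u : ℚ) (x y : Site 2) :
    M3CorrUpperRow tp u (7 / 2)
      (pairRegion (insert 0 unitSteps) x ∪ pairRegion (insert 0 unitSteps) y)
      (fermionEmbed (PolySite.incl Finset.subset_union_left)
          (localPairAt (insert 0 unitSteps) dWaveFormFactor x)ᴴ *
        fermionEmbed (PolySite.incl Finset.subset_union_right)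
          (localPairAt (insert 0 unitSteps) dWaveFormFactor y)) := by
  intro ω Ls ψ hLs hψ hψ1 hω _
  obtain ⟨hTI, hn⟩ := SpinStarTL.m3_rowState_invariances hLs hψ hψ1 hω
  have hD := SpinStarTL.re_expect_doccAt0_nonneg ω (d := 2)
  have h := Observables.SingletPair.abs_re_dWavePairCorr_le_four_mul_density_sub_docc hTI x y
  rw [hn] at h
  rw [← dWavePairCorr_eq_expect]
  push_cast
  linarith [le_abs_self (ω.dWavePairCorr x y).re]

/-- KINEMATIC at density `7/8`: every `d`-wave pair row satisfies `−7/2 ≤ Re ω(P_x† P_y)`.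
[cite: BratteliRobinsonI1987, §2.3.3 (Thm. 2.3.16)] -/
theorem m3_dWavePair_lowerRow_neg_seven_halves (tp : ℝ) (u : ℚ) (x y : Site 2) :
    M3CorrLowerRow tp u (-(7 / 2))
      (pairRegion (insert 0 unitSteps) x ∪ pairRegion (insert 0 unitSteps) y)
      (fermionEmbed (PolySite.incl Finset.subset_union_left)
          (localPairAt (insert 0 unitSteps) dWaveFormFactor x)ᴴ *
        fermionEmbed (PolySite.incl Finset.subset_union_right)
          (localPairAt (insert 0 unitSteps) dWaveFormFactor y)) := by
  intro ω Ls ψ hLs hψ hψ1 hω _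
  obtain ⟨hTI, hn⟩ := SpinStarTL.m3_rowState_invariances hLs hψ hψ1 hω
  have hD := SpinStarTL.re_expect_doccAt0_nonneg ω (d := 2)
  have h := Observables.SingletPair.abs_re_dWavePairCorr_le_four_mul_density_sub_docc hTI x y
  rw [hn] at h
  rw [← dWavePairCorr_eq_expect]
  push_cast
  linarith [neg_abs_le (ω.dWavePairCorr x y).re]

end M3

section Certified

open Summit.Ventures.CertifiedManyBodySolver.Certificates

/-- **DERIVED-CERTIFIED, `t′ = 0`** (claim node #261: docc lower `275845906240274393889863/2^84`, window
`u₁₆₆ = -47814009469263/2^46`): `Re ω(P_x† P_y) ≤ 16649115568364534051996601/2^82 ≈ 3.4429564` (`= 7/2 − 4·dlo`),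
all `x, y`. [cite: BratteliRobinsonI1987, §2.3.3 (Thm. 2.3.16)] -/
theorem m3_dWavePair_tp0_upper_of_r261 (hd : cert_r261_lro_M3U8tp0_w2_b4_kry1_kry2c3_hop2_Dlo)
    (x y : Site 2) :
    M3CorrUpperRow 0 (-47814009469263 / 70368744177664)
      (16649115568364534051996601 / 4835703278458516698824704)
      (pairRegion (insert 0 unitSteps) x ∪ pairRegion (insert 0 unitSteps) y)
      (fermionEmbed (PolySite.incl Finset.subset_union_left)
          (localPairAt (insert 0 unitSteps) dWaveFormFactor x)ᴴ *
        fermionEmbed (PolySite.incl Finset.subset_union_right)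
          (localPairAt (insert 0 unitSteps) dWaveFormFactor y)) := by
  have h := m3_dWavePair_upperRow_of_doccLowerRow
    (M3CorrOrbitLowerRow.doccLowerRow hd Finset.univ_nonempty) x y
  convert h using 2
  all_goals norm_num

/-- **DERIVED-CERTIFIED, `t′ = 0`**: `−16649115568364534051996601/2^82 ≤ Re ω(P_x† P_y)`.
[cite: BratteliRobinsonI1987, §2.3.3 (Thm. 2.3.16)] -/
theorem m3_dWavePair_tp0_lower_of_r261 (hd : cert_r261_lro_M3U8tp0_w2_b4_kry1_kry2c3_hop2_Dlo)
    (x y : Site 2) :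
    M3CorrLowerRow 0 (-47814009469263 / 70368744177664)
      (-(16649115568364534051996601 / 4835703278458516698824704))
      (pairRegion (insert 0 unitSteps) x ∪ pairRegion (insert 0 unitSteps) y)
      (fermionEmbed (PolySite.incl Finset.subset_union_left)
          (localPairAt (insert 0 unitSteps) dWaveFormFactor x)ᴴ *
        fermionEmbed (PolySite.incl Finset.subset_union_right)
          (localPairAt (insert 0 unitSteps) dWaveFormFactor y)) := by
  have h := m3_dWavePair_lowerRow_of_doccLowerRow
    (M3CorrOrbitLowerRow.doccLowerRow hd Finset.univ_nonempty) x y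
  convert h using 2
  all_goals norm_num

/-- **DERIVED-CERTIFIED, `t′ = −1/4`** (claim node #257: docc lower `38455087907569911627595/2^82`, window
`u₁₄₉ = -2948854321395/2^42`): `Re ω(P_x† P_y) ≤ 4192785280743632199844021/2^80 ≈ 3.4681907`, all `x, y`.
[cite: BratteliRobinsonI1987, §2.3.3 (Thm. 2.3.16)] -/
theorem m3_dWavePair_tpm1o4_upper_of_r257 (hd : cert_r257_lro_M3U8tpm1o4_w2_b4_kry1_kry2c3_hop2_Dlo)
    (x y : Site 2) :
    M3CorrUpperRow (-1 / 4) (-2948854321395 / 4398046511104)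
      (4192785280743632199844021 / 1208925819614629174706176)
      (pairRegion (insert 0 unitSteps) x ∪ pairRegion (insert 0 unitSteps) y)
      (fermionEmbed (PolySite.incl Finset.subset_union_left)
          (localPairAt (insert 0 unitSteps) dWaveFormFactor x)ᴴ *
        fermionEmbed (PolySite.incl Finset.subset_union_right)
          (localPairAt (insert 0 unitSteps) dWaveFormFactor y)) := by
  have h := m3_dWavePair_upperRow_of_doccLowerRow
    (M3CorrOrbitLowerRow.doccLowerRow hd Finset.univ_nonempty) x y
  convert h using 2
  all_goals norm_num

/-- **DERIVED-CERTIFIED, `t′ = −1/4`**: `−4192785280743632199844021/2^80 ≤ Re ω(P_x† P_y)`.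
[cite: BratteliRobinsonI1987, §2.3.3 (Thm. 2.3.16)] -/
theorem m3_dWavePair_tpm1o4_lower_of_r257 (hd : cert_r257_lro_M3U8tpm1o4_w2_b4_kry1_kry2c3_hop2_Dlo)
    (x y : Site 2) :
    M3CorrLowerRow (-1 / 4) (-2948854321395 / 4398046511104)
      (-(4192785280743632199844021 / 1208925819614629174706176))
      (pairRegion (insert 0 unitSteps) x ∪ pairRegion (insert 0 unitSteps) y)
      (fermionEmbed (PolySite.incl Finset.subset_union_left)
          (localPairAt (insert 0 unitSteps) dWaveFormFactor x)ᴴ *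
        fermionEmbed (PolySite.incl Finset.subset_union_right)
          (localPairAt (insert 0 unitSteps) dWaveFormFactor y)) := by
  have h := m3_dWavePair_lowerRow_of_doccLowerRow
    (M3CorrOrbitLowerRow.doccLowerRow hd Finset.univ_nonempty) x y
  convert h using 2
  all_goals norm_num

end Certified

end Summit.Ventures.CertifiedManyBodySolver

end
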